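import Literature.NumberTheory.Automorphic.WhittakerBesselGL2
import Literature.NumberTheory.Automorphic.WhittakerCoeffCuspidal
import Literature.NumberTheory.Automorphic.SmoothedCuspForms
import HarnessLib

/-!
# Cuspidality along `N₂`, genericity and continuity of Whittaker coefficients on `GL₂`

Topic `NumberTheory/Automorphic`; namespace `Literature.NumberTheory.Automorphic`. A brick of the
mean-square route to Jacquet–Shalika's Theorem (5.3) for `GL₂`
(`StandardLFunctionData.multipliable_L`; files `WhittakerBesselGL2`, `WhittakerCoeffCuspidal`,
`SmoothedCuspForms`, `UnipotentTateDomain`). The mean-square method starts from a smoothed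
cuspidal vector `φ = invQuot (S_η f)`, `f ∈ L²_cusp(GL₂(𝔸_K) ⧸ A_G GL₂(K))`, and needs three facts
about its global Whittaker coefficient `W_φ` (`whittakerCoeff ν 𝓕_N ψ φ`):

* `setIntegral_unipotentTateDomain_invQuot_smoothedForm_eq_zero` — **the `N₂`-periods of `φ`
  vanish**: `∫_{𝓕_N} φ(u g) dν(u) = 0` for every Haar measure `ν` on `N₂(𝔸_K)` and every `g`.
  This is the constant term of the continuous cusp form `S_η f` along `N₂ = 1 + 𝔫₁`
  (`setIntegral_smoothedForm_unipotent_eq_zero` of `SmoothedCuspForms`, stated on the additive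
  group `𝔫₁(𝔸_K)` with `x (1 + X)`), transported along `Ψ : u ↦ (0 -u₀₁; 0 0)` (`1 + Ψ(u) = u⁻¹`,
  `negBlockEquivGL2`, `unipotentToNegBlock`; the transported measure is an additive Haar measure,
  `isAddHaarMeasure_map_unipotentToNegBlock`) after the change of fundamental domain
  `𝓕_N ↔ 𝓕_N⁻¹` (`isFundamentalDomain_inv_unipotentTateDomain`, `N₂(𝔸_K)` being abelian);
* `exists_whittakerCoeff_invQuot_smoothedForm_ne_zero` — **genericity**: if `S_η f ≠ 0` then some
  `W_φ(g) ≠ 0` (`exists_whittakerCoeff_ne_zero_of_cuspidal` of `WhittakerBesselGL2`, completeness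
  of the characters of `𝔸_K ⧸ K`);
* `continuous_whittakerCoeff` — **`W_φ` is continuous** for continuous `φ`, `ψ` and a relatively
  compact measurable `𝓕` (dominated convergence; general `n`).

Everything is proved; folklore (Jacquet–Langlands (1970), §10; Gelbart (1975), §3: cusp forms on
`GL₂` are generic).
-/

noncomputable section

open MeasureTheory Measure NumberField IsDedekindDomain Matrix Set Filter Topology
open scoped MatrixGroups ENNReal ComplexConjugate Pointwise

namespace Literature.NumberTheory.Automorphic

/-! ### `𝔫₁(R) ≅ R` for `GL₂` -/

section Block

variable {R : Type*} [CommRing R]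

/-- The strictly upper triangular `2 × 2` matrix with entry `x`, as an element of `𝔫₁(R)`.
[folklore] -/
def blockOfEntryGL2 (x : R) : blockNilpotent 2 1 R :=
  ⟨!![0, x; 0, 0], by
    intro i j hij
    fin_cases i <;> fin_cases j <;> simp at hij ⊢⟩

/-- The matrix of `blockOfEntryGL2 x`. [folklore] -/
@[simp]
theorem coe_blockOfEntryGL2 (x : R) :
    ((blockOfEntryGL2 x : blockNilpotent 2 1 R) : Matrix (Fin 2) (Fin 2) R) = !![0, x; 0, 0] := rfl

/-- Every `X ∈ 𝔫₁(R)` (`n = 2`) is `blockOfEntryGL2` of its entry `X₀₁`. [folklore] -/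
theorem blockOfEntryGL2_entry (X : blockNilpotent 2 1 R) :
    blockOfEntryGL2 ((X : Matrix (Fin 2) (Fin 2) R) 0 1) = X := by
  refine Subtype.ext ?_
  rw [coe_blockOfEntryGL2]
  ext i j
  fin_cases i <;> fin_cases j
  · exact (apply_eq_zero_of_mem_blockNilpotent X.2 (by decide)).symm
  · rfl
  · exact (apply_eq_zero_of_mem_blockNilpotent X.2 (by decide)).symm
  · exact (apply_eq_zero_of_mem_blockNilpotent X.2 (by decide)).symm

/-- **`R ≅ 𝔫₁(R)` twisted by a sign**: `x ↦ (0 -x; 0 0)`, an additive equivalence, chosen so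
that `1 + e(x) = n(-x) = n(x)⁻¹`. [folklore] -/
def negBlockEquivGL2 : R ≃+ blockNilpotent 2 1 R where
  toFun x := blockOfEntryGL2 (-x)
  invFun X := -((X : Matrix (Fin 2) (Fin 2) R) 0 1)
  left_inv x := by simp
  right_inv X := by
    change blockOfEntryGL2 (-(-((X : Matrix (Fin 2) (Fin 2) R) 0 1))) = X
    rw [neg_neg, blockOfEntryGL2_entry]
  map_add' x y := by
    refine Subtype.ext ?_
    change (!![0, -(x + y); 0, 0] : Matrix (Fin 2) (Fin 2) R) = !![0, -x; 0, 0] + !![0, -y; 0, 0]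
    ext i j
    fin_cases i <;> fin_cases j <;> simp [add_comm]

/-- `negBlockEquivGL2 x = (0 -x; 0 0)` (definitional). [folklore] -/
@[simp] theorem negBlockEquivGL2_apply (x : R) : negBlockEquivGL2 x = blockOfEntryGL2 (-x) := rfl

/-- `1 + e(x) = n(-x)`. [folklore] -/
theorem unipotentOfBlock_negBlockEquivGL2 (x : R) :
    unipotentOfBlock 2 1 R (Multiplicative.ofAdd (negBlockEquivGL2 x)) =
      ((unipotentGL2 (-x) : ↥(upperUnitriangular (Fin 2) R)) : GL (Fin 2) R) := by
  refine Units.ext ?_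
  rw [coe_unipotentOfBlock, coe_unipotentGL2]
  change (1 : Matrix (Fin 2) (Fin 2) R) + !![0, -x; 0, 0] = !![1, -x; 0, 1]
  ext i j
  fin_cases i <;> fin_cases j <;> simp

section Topology

variable [TopologicalSpace R] [IsTopologicalRing R]

/-- `negBlockEquivGL2` is continuous. [folklore] -/
theorem continuous_negBlockEquivGL2 : Continuous (negBlockEquivGL2 (R := R)) := by
  refine Continuous.subtype_mk ?_ _
  refine continuous_matrix fun i j => ?_
  fin_cases i <;> fin_cases j <;> simp <;> fun_prop

/-- The inverse of `negBlockEquivGL2` is continuous. [folklore] -/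
theorem continuous_negBlockEquivGL2_symm : Continuous (negBlockEquivGL2 (R := R)).symm := by
  change Continuous fun X : blockNilpotent 2 1 R => -((X : Matrix (Fin 2) (Fin 2) R) 0 1)
  exact (continuous_subtype_val.matrix_elem 0 1).neg

end Topology

end Block

/-! ### Vanishing of the `N₂`-periods of smoothed cuspidal vectors -/

section Cuspidal

variable {K : Type} [Field K] [NumberField K]

/-- The map `Ψ : u ↦ (0 -u₀₁; 0 0) : N₂(𝔸_K) → 𝔫₁(𝔸_K)`, with `1 + Ψ(u) = u⁻¹`. [folklore] -/
def unipotentToNegBlock (u : ↥(adelicUnipotent 2 K)) : blockNilpotent 2 1 (AdeleRing (𝓞 K) K) :=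
  negBlockEquivGL2 (((u : GL (Fin 2) (AdeleRing (𝓞 K) K)) : Matrix (Fin 2) (Fin 2) (AdeleRing (𝓞 K) K)) 0 1)

/-- `u⁻¹ = n(-u₀₁)` in `N₂`. [folklore] -/
theorem inv_eq_unipotentGL2_neg (u : ↥(adelicUnipotent 2 K)) :
    u⁻¹ = unipotentGL2 (-((((u : GL (Fin 2) (AdeleRing (𝓞 K) K)) : Matrix (Fin 2) (Fin 2) (AdeleRing (𝓞 K) K)) 0 1))) := by
  rw [inv_eq_iff_mul_eq_one]
  have h := unipotentGL2_entry u
  calc u * unipotentGL2 (-((((u : GL (Fin 2) (AdeleRing (𝓞 K) K)) : Matrix (Fin 2) (Fin 2) (AdeleRing (𝓞 K) K)) 0 1)))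
      = unipotentGL2 ((((u : GL (Fin 2) (AdeleRing (𝓞 K) K)) : Matrix (Fin 2) (Fin 2) (AdeleRing (𝓞 K) K)) 0 1)) *
          unipotentGL2 (-((((u : GL (Fin 2) (AdeleRing (𝓞 K) K)) : Matrix (Fin 2) (Fin 2) (AdeleRing (𝓞 K) K)) 0 1))) := by
        rw [h]
    _ = 1 := by rw [← unipotentGL2_add, add_neg_cancel, unipotentGL2_zero]

/-- `1 + Ψ(u) = u⁻¹`. [folklore] -/
theorem glUnipotent_unipotentToNegBlock (u : ↥(adelicUnipotent 2 K)) :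
    glUnipotent 2 1 K (Multiplicative.ofAdd (unipotentToNegBlock u)) =
      ((u⁻¹ : ↥(adelicUnipotent 2 K)) : GL (Fin 2) (AdeleRing (𝓞 K) K)) := by
  rw [glUnipotent_apply, unipotentToNegBlock, unipotentOfBlock_negBlockEquivGL2, inv_eq_unipotentGL2_neg]

/-- `Ψ` is a homeomorphism `N₂(𝔸_K) ≃ₜ 𝔫₁(𝔸_K)`. [folklore] -/
def unipotentToNegBlockHomeomorph : ↥(adelicUnipotent 2 K) ≃ₜ blockNilpotent 2 1 (AdeleRing (𝓞 K) K) :=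
  (unipotentHomeomorphGL2 (R := AdeleRing (𝓞 K) K)).symm.trans
    { toEquiv := (negBlockEquivGL2 (R := AdeleRing (𝓞 K) K)).toEquiv
      continuous_toFun := continuous_negBlockEquivGL2
      continuous_invFun := continuous_negBlockEquivGL2_symm }

/-- `unipotentToNegBlockHomeomorph` is `Ψ`. [folklore] -/
@[simp] theorem unipotentToNegBlockHomeomorph_apply (u : ↥(adelicUnipotent 2 K)) :
    unipotentToNegBlockHomeomorph u = unipotentToNegBlock u := rfl

/-- `N₂(𝔸_K)` is commutative. [folklore] -/
theorem adelicUnipotent_two_mul_comm (u v : ↥(adelicUnipotent 2 K)) : u * v = v * u := by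
  rw [← unipotentGL2_entry u, ← unipotentGL2_entry v, ← unipotentGL2_add, ← unipotentGL2_add, add_comm]

variable [MeasurableSpace ↥(adelicUnipotent 2 K)] [BorelSpace ↥(adelicUnipotent 2 K)]

/-- **The transported measure on `𝔫₁(𝔸_K)` is an additive Haar measure** (the image of the
additive Haar measure `entryMeasure ν` of `𝔸_K` under the continuous additive equivalence
`x ↦ (0 -x; 0 0)`). [folklore] -/
theorem isAddHaarMeasure_map_unipotentToNegBlock [MeasurableSpace (AdeleRing (𝓞 K) K)]
    [BorelSpace (AdeleRing (𝓞 K) K)] (ν : Measure ↥(adelicUnipotent 2 K)) [IsHaarMeasure ν] :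
    (ν.map unipotentToNegBlock).IsAddHaarMeasure := by
  have h : ν.map unipotentToNegBlock =
      (entryMeasure ν).map (negBlockEquivGL2 (R := AdeleRing (𝓞 K) K)) := by
    rw [entryMeasure, Measure.map_map continuous_negBlockEquivGL2.measurable
      measurableEmbedding_entry_zero_one.measurable]
    rfl
  rw [h]
  exact AddEquiv.isAddHaarMeasure_map (entryMeasure ν) (negBlockEquivGL2 (R := AdeleRing (𝓞 K) K))
    continuous_negBlockEquivGL2 continuous_negBlockEquivGL2_symm

/-- **The inverse box is a fundamental domain**: `𝓕_N⁻¹` is a fundamental domain for `N₂(K)`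
(inversion intertwines `γ • u` with `γ⁻¹ • u⁻¹` in the abelian group `N₂(𝔸_K)` and quasi-preserves
the Haar measure). [folklore] -/
theorem isFundamentalDomain_inv_unipotentTateDomain (ν : Measure ↥(adelicUnipotent 2 K)) [IsHaarMeasure ν] :
    IsFundamentalDomain ↥(rationalUnipotent 2 K) ((unipotentTateDomain 2 K)⁻¹) ν := by
  have h := isFundamentalDomain_unipotentTateDomain (n := 2) (K := K) ν
  have himage : (unipotentTateDomain 2 K)⁻¹ = (Equiv.inv ↥(adelicUnipotent 2 K)) '' unipotentTateDomain 2 K := by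
    rw [Equiv.image_eq_preimage_symm]; rfl
  rw [himage]
  refine h.image_of_equiv (Equiv.inv _) ?_ (Equiv.inv ↥(rationalUnipotent 2 K)) ?_
  · change QuasiMeasurePreserving (fun u : ↥(adelicUnipotent 2 K) => u⁻¹) ν ν
    exact quasiMeasurePreserving_inv ν
  · intro γ u
    change (γ⁻¹ • u)⁻¹ = γ • u⁻¹
    rw [Subgroup.smul_def, Subgroup.smul_def, smul_eq_mul, smul_eq_mul, _root_.mul_inv_rev, Subgroup.coe_inv,
      inv_inv, adelicUnipotent_two_mul_comm]

/-- **Smoothed cuspidal vectors have vanishing `N₂`-periods.** For `f ∈ L²_cusp(GL₂)`, a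
continuous compactly supported weight `η`, `φ = invQuot (S_η f)` and every Haar measure `ν` on
`N₂(𝔸_K)`: `∫_{𝓕_N} φ(u g) dν(u) = 0` for all `g ∈ GL₂(𝔸_K)`. This is the constant term of the
continuous cusp form `S_η f` along the unipotent radical `N₂ = 1 + 𝔫₁` of the Borel subgroup
(`setIntegral_smoothedForm_unipotent_eq_zero`, `SmoothedCuspForms`), transported along
`u ↦ (0 -u₀₁; 0 0)` (`1 + Ψ(u) = u⁻¹`) after the change of fundamental domain `𝓕_N ↔ 𝓕_N⁻¹`.
[folklore] -/
theorem setIntegral_unipotentTateDomain_invQuot_smoothedForm_eq_zero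
    {μ : Measure (AdelicGroupData.gl 2 K).automorphicQuotient} [(AdelicGroupData.gl 2 K).IsAutomorphicMeasure μ]
    {η : (AdelicGroupData.gl 2 K).Adelic → ℝ} (hη : Continuous η) (hηs : HasCompactSupport η)
    {f : (AdelicGroupData.gl 2 K).L2 μ} (hf : f ∈ cuspidalSubspace 2 K μ)
    (ν : Measure ↥(adelicUnipotent 2 K)) [IsHaarMeasure ν] (g : GL (Fin 2) (AdeleRing (𝓞 K) K)) :
    ∫ u in unipotentTateDomain 2 K,
      invQuot (AdelicGroupData.gl 2 K) (smoothedForm η f) ((u : GL (Fin 2) (AdeleRing (𝓞 K) K)) * g) ∂ν = 0 := by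
  borelize (AdeleRing (𝓞 K) K)
  set φ := invQuot (AdelicGroupData.gl 2 K) (smoothedForm η f) with hφ
  -- change the fundamental domain to `𝓕_N⁻¹`
  have hinv : ∀ (γ : ↥(rationalUnipotent 2 K)) (u : ↥(adelicUnipotent 2 K)),
      φ (((γ • u : ↥(adelicUnipotent 2 K)) : GL (Fin 2) (AdeleRing (𝓞 K) K)) * g) =
        φ ((u : GL (Fin 2) (AdeleRing (𝓞 K) K)) * g) := by
    intro γ u
    rw [Subgroup.smul_def, smul_eq_mul, Subgroup.coe_mul, mul_assoc]
    obtain ⟨γ₀, hγ₀⟩ := (mem_rationalUnipotent_iff (γ : ↥(adelicUnipotent 2 K))).1 γ.2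
    exact isLeftInvariant_invQuot _ _ _ ⟨γ₀, hγ₀⟩ _
  rw [(isFundamentalDomain_unipotentTateDomain ν).setIntegral_eq (isFundamentalDomain_inv_unipotentTateDomain ν) hinv]
  -- transport to `𝔫₁(𝔸_K)`
  set Ψ := (unipotentToNegBlockHomeomorph (K := K)) with hΨ
  have hΨm : MeasurableEmbedding Ψ := Ψ.measurableEmbedding
  have hinventry : ∀ u : ↥(adelicUnipotent 2 K),
      (((u⁻¹ : ↥(adelicUnipotent 2 K)) : GL (Fin 2) (AdeleRing (𝓞 K) K)) : Matrix (Fin 2) (Fin 2) (AdeleRing (𝓞 K) K)) 0 1 =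
        -((((u : GL (Fin 2) (AdeleRing (𝓞 K) K)) : Matrix (Fin 2) (Fin 2) (AdeleRing (𝓞 K) K)) 0 1)) := by
    intro u
    rw [inv_eq_unipotentGL2_neg, unipotentGL2_apply_zero_one]
  have hpre : (unipotentTateDomain 2 K)⁻¹ = Ψ ⁻¹' blockFundamentalDomain 2 1 K := by
    ext u
    have e00 : ((Ψ u : blockNilpotent 2 1 (AdeleRing (𝓞 K) K)) : Matrix (Fin 2) (Fin 2) (AdeleRing (𝓞 K) K)) 0 0 = 0 := rfl
    have e01 : ((Ψ u : blockNilpotent 2 1 (AdeleRing (𝓞 K) K)) : Matrix (Fin 2) (Fin 2) (AdeleRing (𝓞 K) K)) 0 1 =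
        -((((u : GL (Fin 2) (AdeleRing (𝓞 K) K)) : Matrix (Fin 2) (Fin 2) (AdeleRing (𝓞 K) K)) 0 1)) := rfl
    have e10 : ((Ψ u : blockNilpotent 2 1 (AdeleRing (𝓞 K) K)) : Matrix (Fin 2) (Fin 2) (AdeleRing (𝓞 K) K)) 1 0 = 0 := rfl
    have e11 : ((Ψ u : blockNilpotent 2 1 (AdeleRing (𝓞 K) K)) : Matrix (Fin 2) (Fin 2) (AdeleRing (𝓞 K) K)) 1 1 = 0 := rfl
    rw [Set.mem_inv, mem_preimage, mem_blockFundamentalDomain, mem_unipotentTateDomain_iff]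
    simp only [Fin.forall_fin_two]
    rw [hinventry, e00, e01, e10, e11]
    have h0 := zero_mem_adeleFundamentalDomain K
    constructor
    · rintro ⟨⟨-, h⟩, -⟩
      exact ⟨⟨h0, h (by decide)⟩, ⟨h0, h0⟩⟩
    · rintro ⟨⟨-, h⟩, -⟩
      exact ⟨⟨fun hh => absurd hh (lt_irrefl _), fun _ => h⟩, ⟨fun hh => absurd hh (by decide), fun hh => absurd hh (lt_irrefl _)⟩⟩
  haveI := isAddHaarMeasure_map_unipotentToNegBlock ν
  have hmap : ν.map unipotentToNegBlock = ν.map Ψ := rfl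
  have hcusp := setIntegral_smoothedForm_unipotent_eq_zero (n := 2) (k := 1) one_pos one_lt_two hη hηs hf
    (ν.map unipotentToNegBlock) g⁻¹
  rw [hmap, hΨm.setIntegral_map] at hcusp
  rw [hpre, ← hcusp]
  refine setIntegral_congr_fun (hΨm.measurable (measurableSet_blockFundamentalDomain 2 1 K)) fun u _ => ?_
  rw [hφ, invQuot_apply, hΨ, unipotentToNegBlockHomeomorph_apply, glUnipotent_unipotentToNegBlock, Subgroup.coe_inv]
  congr 2

end Cuspidal

/-! ### Continuity of the Whittaker coefficient -/

section Continuity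

variable {n : ℕ} {K : Type} [Field K] [NumberField K]
  [MeasurableSpace ↥(adelicUnipotent n K)] [BorelSpace ↥(adelicUnipotent n K)]

/-- **The global Whittaker coefficient of a continuous function is continuous**: for continuous
`φ` and `ψ`, a measure `ν` finite on compacts and a measurable `𝓕` with compact closure,
`g ↦ W_φ(g) = ν(𝓕)⁻¹ ∫_𝓕 φ(u g) conj ψ_N(u) dν(u)` is continuous (dominated convergence: on a compact
neighbourhood `C` of `g₀` the integrand is bounded by `max |φ|` on the compact `closure 𝓕 · C`).
[folklore] -/
theorem continuous_whittakerCoeff {ν : Measure ↥(adelicUnipotent n K)} [IsFiniteMeasureOnCompacts ν]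
    {𝓕 : Set ↥(adelicUnipotent n K)} (h𝓕m : MeasurableSet 𝓕) (h𝓕c : IsCompact (closure 𝓕))
    {ψ : AddChar (AdeleRing (𝓞 K) K) Circle} (hψ : Continuous ψ)
    {φ : GL (Fin n) (AdeleRing (𝓞 K) K) → ℂ} (hφ : Continuous φ) :
    Continuous (whittakerCoeff ν 𝓕 ψ φ) := by
  haveI : T2Space (AdeleRing (𝓞 K) K) := t2Space_adeleRing K
  haveI : LocallyCompactSpace (GL (Fin n) (AdeleRing (𝓞 K) K)) :=
    AdelicGroupData.locallyCompactSpace_generalLinearGroup_adeleRing K (Fin n)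
  haveI := secondCountableTopology_generalLinearGroup_adeleRing K (Fin n)
  have hχc : Continuous fun u : ↥(adelicUnipotent n K) => conj (whittakerCharFun ψ u) :=
    (continuous_whittakerCharFun hψ).star
  have hfin : IsFiniteMeasure (ν.restrict 𝓕) :=
    isFiniteMeasure_restrict.2 ((measure_mono subset_closure).trans_lt h𝓕c.measure_lt_top).ne
  have hcont : Continuous fun g => ∫ u in 𝓕, φ ((u : GL (Fin n) (AdeleRing (𝓞 K) K)) * g) *
      conj (whittakerCharFun ψ u) ∂ν := by
    refine continuous_iff_continuousAt.2 fun g₀ => ?_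
    obtain ⟨C, hCc, hCn⟩ := exists_compact_mem_nhds g₀
    have hcomp : IsCompact ((Subtype.val '' closure 𝓕) * C) := (h𝓕c.image continuous_subtype_val).mul hCc
    obtain ⟨M, hM⟩ := hcomp.exists_bound_of_continuousOn hφ.continuousOn
    refine continuousAt_of_dominated (μ := ν.restrict 𝓕) (bound := fun _ => M) ?_ ?_ (integrable_const M) ?_
    · exact Eventually.of_forall fun g =>
        ((hφ.comp ((continuous_subtype_val.comp continuous_id).mul continuous_const)).mul hχc).aestronglyMeasurable
    · filter_upwards [hCn] with g hg
      refine (ae_restrict_iff' h𝓕m).2 (Eventually.of_forall fun u hu => ?_)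
      rw [norm_mul, Complex.norm_conj, whittakerCharFun_apply, Circle.norm_coe, mul_one]
      exact hM _ (Set.mul_mem_mul ⟨u, subset_closure hu, rfl⟩ hg)
    · exact Eventually.of_forall fun u =>
        ((hφ.comp (continuous_const.mul continuous_id)).mul continuous_const).continuousAt
  have heq : whittakerCoeff ν 𝓕 ψ φ = fun g => ((ν 𝓕).toReal⁻¹ : ℝ) •
      ∫ u in 𝓕, φ ((u : GL (Fin n) (AdeleRing (𝓞 K) K)) * g) * conj (whittakerCharFun ψ u) ∂ν := rfl
  rw [heq]
  exact hcont.const_smul ((ν 𝓕).toReal⁻¹ : ℝ)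

end Continuity

/-! ### Genericity of smoothed cuspidal vectors on `GL₂` -/

section Generic

variable {K : Type} [Field K] [NumberField K]
  {μ : Measure (AdelicGroupData.gl 2 K).automorphicQuotient} [(AdelicGroupData.gl 2 K).IsAutomorphicMeasure μ]
  [MeasurableSpace ↥(adelicUnipotent 2 K)] [BorelSpace ↥(adelicUnipotent 2 K)]
  [MeasurableSpace (AdeleRing (𝓞 K) K)] [BorelSpace (AdeleRing (𝓞 K) K)]
  [MeasurableSpace (adeleQuotient K)] [BorelSpace (adeleQuotient K)]

/-- **Non-zero smoothed cuspidal vectors on `GL₂` are generic**: if `S_η f ≠ 0` (as a function) for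
`f ∈ L²_cusp(GL₂)`, then some Whittaker coefficient `W_φ(g)`, `φ = invQuot (S_η f)`, `ψ` Tate's
character, is non-zero (`exists_whittakerCoeff_ne_zero_of_cuspidal` of `WhittakerBesselGL2` with
the cuspidality `setIntegral_unipotentTateDomain_invQuot_smoothedForm_eq_zero`).
[folklore] -/
theorem exists_whittakerCoeff_invQuot_smoothedForm_ne_zero
    {η : (AdelicGroupData.gl 2 K).Adelic → ℝ} (hη : Continuous η) (hηs : HasCompactSupport η)
    {f : (AdelicGroupData.gl 2 K).L2 μ} (hf : f ∈ cuspidalSubspace 2 K μ) (hne : smoothedForm η f ≠ 0)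
    (ν : Measure ↥(adelicUnipotent 2 K)) [IsHaarMeasure ν] :
    ∃ g : GL (Fin 2) (AdeleRing (𝓞 K) K),
      whittakerCoeff ν (unipotentTateDomain 2 K) (adeleAddChar K)
        (invQuot (AdelicGroupData.gl 2 K) (smoothedForm η f)) g ≠ 0 := by
  refine exists_whittakerCoeff_ne_zero_of_cuspidal (isLeftInvariant_invQuot _ _) ?_ ν
    (setIntegral_unipotentTateDomain_invQuot_smoothedForm_eq_zero hη hηs hf ν) ?_
  · exact (continuous_smoothedForm hη hηs f).comp
      ((AdelicGroupData.gl 2 K).continuous_toAutomorphicQuotient.comp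
        (continuous_inv : Continuous fun g : (AdelicGroupData.gl 2 K).Adelic => g⁻¹))
  · intro h
    apply hne
    funext x
    obtain ⟨g, rfl⟩ := QuotientGroup.mk_surjective x
    have := congrFun h g⁻¹
    rw [invQuot_apply, inv_inv] at this
    exact this

end Generic

end Literature.NumberTheory.Automorphic
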